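import Summits.AnomalousDissipation.AnomalousDissipation.Theorems.DenseLoudDesignerForces.Negative.MomentumBudget

/-!
# Negative knowledge for the crux `DenseLoudDesignerForces` (stmt-AnomalousDissipation-1143), IV: window bounds

Certified copy of §6 of the cdisprove work file: on `LOUD_j`, `|∫⟪f_c,φ⟫| ≤ ‖Dφ‖_∞E + (E+∫‖Δφ‖²)/(2(j+1))`;
on a WINDOW (all levels, continuity in `c`) `|∫⟪f_c,φ⟫| ≤ ‖Dφ‖_∞E` for every steady smooth solenoidal test
field, `∫‖f_c‖² ≤ Λ(c)E` with the gradient bound `Λ(c) = 2π∑ᵢ∑_k|kᵢ|‖c k‖`, and the HEADLINE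
`ε² ≤ Λ(c)E² ≤ Λ₁(S)‖c‖E²` at every point of every window.  Supports stmt-AnomalousDissipation-1143.
-/

noncomputable section

namespace Summit.AnomalousDissipation.AnomalousDissipation.Theorems.DenseLoudDesignerForces.Negative

open scoped BigOperators Topology ENNReal InnerProductSpace
open Filter Set MeasureTheory UnitAddTorus
open Literature.Analysis.FunctionSpaces Literature.Analysis.FluidPDE
open Summit.AnomalousDissipation.AnomalousDissipation.Theses.BaireTransfer

/-! ## §6 Consequences for the crux: loud and window forces are bounded by the ENERGY budget

On `LOUD_j(S,E,ε)`: `|∫⟪f_c, φ⟫| ≤ ‖∇φ‖_∞ E + (E + ∫‖Δφ‖²)/(2(j+1))`; on a window `U` (all levels, by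
continuity in `c` and closedness): `|∫⟪f_c, φ⟫| ≤ ‖∇φ‖_∞ E` for EVERY steady smooth solenoidal `φ`.
With `φ = f_c`: `∫‖f_c‖² ≤ Λ(c)·E` where `Λ(c) = 2π ∑ᵢ ∑_{k∈S} |kᵢ| ‖c k‖` bounds `‖∇f_c‖_∞`, and with the
power budget the HEADLINE `ε² ≤ Λ(c)·E²` on every window: the dissipation floor is at most the energy
budget times the square root of the force GRADIENT — windows with small forces need `ε ≪ E`. -/

section Consequences

variable {S : Finset (Fin 3 → ℤ)}

/-- The Leray multiplier is continuous. -/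
theorem continuous_lerayCoeff (k : Fin 3 → ℤ) : Continuous (Torus.lerayCoeff (d := Fin 3) k) := by
  by_cases hk : k = 0
  · subst hk
    have : (Torus.lerayCoeff (d := Fin 3) 0) = fun _ => 0 := funext fun c => Torus.lerayCoeff_zero c
    rw [this]; exact continuous_const
  · have : (Torus.lerayCoeff (d := Fin 3) k) = Torus.leraySym k := funext fun c => Torus.lerayCoeff_of_ne_zero hk c
    rw [this]; exact Torus.continuous_leraySym k

/-- Coordinates of the zero extension depend continuously on the coefficient vector. -/
theorem continuous_coeffExt (k : Fin 3 → ℤ) : Continuous fun c : ↥S → (EuclideanSpace ℂ (Fin 3)) => Torus.coeffExt S c k := by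
  by_cases hk : k ∈ S
  · simp_rw [Torus.coeffExt_of_mem _ hk]; exact continuous_apply _
  · simp_rw [Torus.coeffExt_of_not_mem _ hk]; exact continuous_const

/-- Joint continuity of `(c, x) ↦ f_c(x)`. -/
theorem continuous_force_uncurry (S : Finset (Fin 3 → ℤ)) :
    Continuous (Function.uncurry (force S)) := by
  have h : Function.uncurry (force S) = fun q : (↥S → (EuclideanSpace ℂ (Fin 3))) × (UnitAddTorus (Fin 3)) =>
      EuclideanSpace.realPart (∑ k ∈ S, mFourier k q.2 • Torus.lerayCoeff k (Torus.coeffExt S q.1 k)) := by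
    funext q; rfl
  rw [h]
  refine EuclideanSpace.realPart.continuous.comp (continuous_finsetSum S fun k _ => ?_)
  exact ((mFourier k).continuous.comp continuous_snd).smul
    ((continuous_lerayCoeff k).comp ((continuous_coeffExt k).comp continuous_fst))

/-- `c ↦ f_c(x)` is continuous. -/
theorem continuous_force_apply (S : Finset (Fin 3 → ℤ)) (x : (UnitAddTorus (Fin 3))) : Continuous fun c : ↥S → (EuclideanSpace ℂ (Fin 3)) => force S c x :=
  (continuous_force_uncurry S).uncurry_right x

/-- The pairing `c ↦ ∫⟪f_c, φ⟫` with a continuous field is continuous on `P_S`. -/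
theorem continuous_pairing (S : Finset (Fin 3 → ℤ)) {φ : (UnitAddTorus (Fin 3)) → (EuclideanSpace ℝ (Fin 3))} (hφ : Continuous φ) :
    Continuous fun c : ↥S → (EuclideanSpace ℂ (Fin 3)) => ∫ x, ⟪force S c x, φ x⟫_ℝ := by
  have hj : Continuous (Function.uncurry fun (c : ↥S → (EuclideanSpace ℂ (Fin 3))) (x : (UnitAddTorus (Fin 3))) => ⟪force S c x, φ x⟫_ℝ) :=
    (continuous_force_uncurry S).inner (hφ.comp continuous_snd)
  simpa only [Measure.restrict_univ] using
    continuous_parametric_integral_of_continuous (μ := (volume : Measure (UnitAddTorus (Fin 3)))) hj isCompact_univ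

/-- The energy profile `c ↦ ∫‖f_c‖²` is continuous on `P_S`. -/
theorem continuous_forceEnergy (S : Finset (Fin 3 → ℤ)) :
    Continuous fun c : ↥S → (EuclideanSpace ℂ (Fin 3)) => ∫ x, ‖force S c x‖ ^ 2 := by
  have hj : Continuous (Function.uncurry fun (c : ↥S → (EuclideanSpace ℂ (Fin 3))) (x : (UnitAddTorus (Fin 3))) => ‖force S c x‖ ^ 2) :=
    (continuous_force_uncurry S).norm.pow 2
  simpa only [Measure.restrict_univ] using
    continuous_parametric_integral_of_continuous (μ := (volume : Measure (UnitAddTorus (Fin 3)))) hj isCompact_univ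

variable {E ε : ℝ} {φ : (UnitAddTorus (Fin 3)) → (EuclideanSpace ℝ (Fin 3))} {M : ℝ}

/-- A derivative bound forces `M ≥ 0`. -/
theorem nonneg_of_fderiv_bound (hM : ∀ x w, ‖Torus.fderiv φ x w‖ ≤ M * ‖w‖) : 0 ≤ M := by
  have h := hM 0 (EuclideanSpace.single 0 1)
  rw [PiLp.norm_single, norm_one, mul_one] at h
  exact (norm_nonneg _).trans h

/-- MOMENTUM BUDGET ON A LOUD SET: `c ∈ LOUD_j(S,E,ε)` ⇒
`|∫⟪f_c, φ⟫| ≤ M E + (E + ∫‖Δφ‖²) / (2(j+1))` for every steady smooth solenoidal `φ` with `‖Dφ‖ ≤ M`. -/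
theorem abs_pairing_le_of_mem_loudSet {j : ℕ} {c : ↥S → (EuclideanSpace ℂ (Fin 3))} (hc : c ∈ loudSet S E ε j)
    (hφ : Torus.IsSmooth φ) (hdiv : Torus.IsDivFree φ) (hM : ∀ x w, ‖Torus.fderiv φ x w‖ ≤ M * ‖w‖) :
    |∫ x, ⟪force S c x, φ x⟫_ℝ| ≤ M * E + (E + ∫ x, ‖Torus.laplacian φ x‖ ^ 2) / (2 * ((j : ℝ) + 1)) := by
  obtain ⟨ν, hν, hνj, τ, u, p, hτ, hsol, hper, hEu, -⟩ := hc
  have hM0 := nonneg_of_fderiv_bound hM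
  have h := abs_integral_inner_force_le hsol hν.le hφ hdiv hM hper hτ
  have hmE := meanEnergy_nonneg' hper hτ
  have hL : 0 ≤ ∫ x, ‖Torus.laplacian φ x‖ ^ 2 := integral_nonneg fun _ => sq_nonneg _
  have hj : (0 : ℝ) < (j : ℝ) + 1 := by positivity
  refine h.trans ?_
  have h1 : M * meanEnergy u ≤ M * E := mul_le_mul_of_nonneg_left hEu hM0
  have h2 : ν / 2 * (meanEnergy u + ∫ x, ‖Torus.laplacian φ x‖ ^ 2) ≤
      (E + ∫ x, ‖Torus.laplacian φ x‖ ^ 2) / (2 * ((j : ℝ) + 1)) := by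
    rw [div_mul_eq_mul_div, div_le_div_iff₀ two_pos (by positivity)]
    have h3 : ν * ((j : ℝ) + 1) ≤ 1 := by
      have := hνj.le; rwa [le_div_iff₀ hj] at this
    calc ν * (meanEnergy u + ∫ x, ‖Torus.laplacian φ x‖ ^ 2) * (2 * ((j : ℝ) + 1))
        = (ν * ((j : ℝ) + 1)) * (meanEnergy u + ∫ x, ‖Torus.laplacian φ x‖ ^ 2) * 2 := by ring
      _ ≤ 1 * (E + ∫ x, ‖Torus.laplacian φ x‖ ^ 2) * 2 := by gcongr
      _ = (E + ∫ x, ‖Torus.laplacian φ x‖ ^ 2) * 2 := by ring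
  linarith

/-- … and the same bound persists on the CLOSURE of the loud set (continuity of the pairing). -/
theorem abs_pairing_le_of_mem_closure_loudSet {j : ℕ} {c : ↥S → (EuclideanSpace ℂ (Fin 3))} (hc : c ∈ closure (loudSet S E ε j))
    (hφ : Torus.IsSmooth φ) (hdiv : Torus.IsDivFree φ) (hM : ∀ x w, ‖Torus.fderiv φ x w‖ ≤ M * ‖w‖) :
    |∫ x, ⟪force S c x, φ x⟫_ℝ| ≤ M * E + (E + ∫ x, ‖Torus.laplacian φ x‖ ^ 2) / (2 * ((j : ℝ) + 1)) := by
  have hclosed : IsClosed {c : ↥S → (EuclideanSpace ℂ (Fin 3)) | |∫ x, ⟪force S c x, φ x⟫_ℝ| ≤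
      M * E + (E + ∫ x, ‖Torus.laplacian φ x‖ ^ 2) / (2 * ((j : ℝ) + 1))} :=
    isClosed_le (continuous_abs.comp (continuous_pairing S hφ.continuous)) continuous_const
  exact closure_minimal (fun c hc => abs_pairing_le_of_mem_loudSet hc hφ hdiv hM) hclosed hc

/-- MOMENTUM BUDGET ON A WINDOW: for `c` in a window, `|∫⟪f_c, φ⟫| ≤ ‖Dφ‖_∞ · E` for every steady smooth
solenoidal `φ` — uniformly in the level, the viscous remainder having gone to zero. -/
theorem abs_pairing_le_of_window {U : Set (↥S → (EuclideanSpace ℂ (Fin 3)))} (hU : IsWindow S E ε U) {c : ↥S → (EuclideanSpace ℂ (Fin 3))} (hc : c ∈ U)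
    (hφ : Torus.IsSmooth φ) (hdiv : Torus.IsDivFree φ) (hM : ∀ x w, ‖Torus.fderiv φ x w‖ ≤ M * ‖w‖) :
    |∫ x, ⟪force S c x, φ x⟫_ℝ| ≤ M * E := by
  set K : ℝ := E + ∫ x, ‖Torus.laplacian φ x‖ ^ 2 with hK
  refine le_of_forall_pos_le_add fun δ hδ => ?_
  obtain ⟨j, hj⟩ := exists_nat_gt (|K| / (2 * δ))
  have hj1 : (0 : ℝ) < 2 * ((j : ℝ) + 1) := by positivity
  have h := abs_pairing_le_of_mem_closure_loudSet (hU.2.2 j hc) hφ hdiv hM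
  have hKj : K / (2 * ((j : ℝ) + 1)) ≤ δ := by
    rw [div_le_iff₀ hj1]
    have h1 : |K| / (2 * δ) < (j : ℝ) + 1 := hj.trans (lt_add_one _)
    rw [div_lt_iff₀ (by positivity)] at h1
    calc K ≤ |K| := le_abs_self K
      _ ≤ ((j : ℝ) + 1) * (2 * δ) := h1.le
      _ = δ * (2 * ((j : ℝ) + 1)) := by ring
  linarith

/-! ### The test field `φ = f_c` -/

/-- The designer force is divergence free (the Leray multiplier is transversal). -/
theorem isDivFree_force (S : Finset (Fin 3 → ℤ)) (c : ↥S → (EuclideanSpace ℂ (Fin 3))) : Torus.IsDivFree (force S c) := by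
  refine Torus.isDivFree_realTrigPoly fun k _ => ?_
  by_cases hk : k = 0
  · subst hk; simp
  · rw [Torus.lerayCoeff_of_ne_zero hk]; exact Torus.sum_mul_leraySym_apply k _

/-- Sup bound for a vector trigonometric polynomial: `‖∑ e_k(x) g_k‖ ≤ ∑ ‖g_k‖`. -/
theorem norm_trigPoly_apply_le (S : Finset (Fin 3 → ℤ)) (g : (Fin 3 → ℤ) → (EuclideanSpace ℂ (Fin 3))) (x : (UnitAddTorus (Fin 3))) :
    ‖Torus.trigPoly S g x‖ ≤ ∑ k ∈ S, ‖g k‖ := by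
  rw [Torus.trigPoly_apply]
  refine (norm_sum_le _ _).trans (Finset.sum_le_sum fun k _ => ?_)
  rw [norm_smul]
  calc ‖mFourier k x‖ * ‖g k‖ ≤ 1 * ‖g k‖ :=
        mul_le_mul_of_nonneg_right (((mFourier k).norm_coe_le_norm x).trans_eq mFourier_norm) (norm_nonneg _)
    _ = ‖g k‖ := one_mul _

/-- The GRADIENT BOUND `Λ(c) = 2π ∑ᵢ ∑_{k∈S} |kᵢ| ‖c k‖` of the designer force `f_c`. -/
def gradBound (S : Finset (Fin 3 → ℤ)) (c : ↥S → (EuclideanSpace ℂ (Fin 3))) : ℝ :=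
  ∑ i : Fin 3, ∑ k : ↥S, 2 * Real.pi * |(((k : Fin 3 → ℤ) i : ℤ) : ℝ)| * ‖c k‖

/-- `0 ≤ Λ(c)`. -/
theorem gradBound_nonneg (S : Finset (Fin 3 → ℤ)) (c : ↥S → (EuclideanSpace ℂ (Fin 3))) : 0 ≤ gradBound S c :=
  Finset.sum_nonneg fun _ _ => Finset.sum_nonneg fun _ _ => by positivity

/-- `Λ(c) ≤ Λ₁(S) ‖c‖` with `Λ₁(S) = 2π ∑ᵢ ∑_{k∈S} |kᵢ|`: the gradient bound is linear in the sup norm of `c`. -/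
theorem gradBound_le (S : Finset (Fin 3 → ℤ)) (c : ↥S → (EuclideanSpace ℂ (Fin 3))) :
    gradBound S c ≤ (∑ i : Fin 3, ∑ k : ↥S, 2 * Real.pi * |(((k : Fin 3 → ℤ) i : ℤ) : ℝ)|) * ‖c‖ := by
  unfold gradBound
  rw [Finset.sum_mul]
  refine Finset.sum_le_sum fun i _ => ?_
  rw [Finset.sum_mul]
  refine Finset.sum_le_sum fun k _ => ?_
  gcongr
  exact norm_le_pi_norm c k

/-- Partial derivatives of the designer force are bounded by `∑_{k∈S} 2π|kᵢ| ‖c k‖` pointwise. -/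
theorem norm_partialDeriv_force_le (S : Finset (Fin 3 → ℤ)) (c : ↥S → (EuclideanSpace ℂ (Fin 3))) (i : Fin 3) (x : (UnitAddTorus (Fin 3))) :
    ‖Torus.partialDeriv i (force S c) x‖ ≤ ∑ k : ↥S, 2 * Real.pi * |(((k : Fin 3 → ℤ) i : ℤ) : ℝ)| * ‖c k‖ := by
  unfold force
  rw [Torus.partialDeriv_realTrigPoly, Torus.realTrigPoly_apply]
  refine (norm_realPart_le _).trans ((norm_trigPoly_apply_le S _ x).trans ?_)
  rw [← Finset.sum_coe_sort]
  refine Finset.sum_le_sum fun k _ => ?_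
  rw [norm_smul, Torus.coeffExt_coe]
  have h1 : ‖(2 * Real.pi * Complex.I * ((k : Fin 3 → ℤ) i : ℂ))‖ = 2 * Real.pi * |(((k : Fin 3 → ℤ) i : ℤ) : ℝ)| := by
    rw [norm_mul, norm_mul, norm_mul, Complex.norm_I, mul_one, Complex.norm_intCast, Complex.norm_ofNat,
      Complex.norm_real, Real.norm_eq_abs, abs_of_pos Real.pi_pos]
  rw [h1]
  gcongr
  exact norm_lerayCoeff_le _ _

/-- GRADIENT BOUND: `‖Df_c(x) w‖ ≤ Λ(c) ‖w‖`. -/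
theorem norm_fderiv_force_le (S : Finset (Fin 3 → ℤ)) (c : ↥S → (EuclideanSpace ℂ (Fin 3))) (x : (UnitAddTorus (Fin 3))) (w : (EuclideanSpace ℝ (Fin 3))) :
    ‖Torus.fderiv (force S c) x w‖ ≤ gradBound S c * ‖w‖ := by
  rw [Torus.fderiv_apply_eq_sum_partialDeriv ((isSmooth_force S c).isContDiff (by simp)) x w]
  refine (norm_sum_le _ _).trans ?_
  unfold gradBound
  rw [Finset.sum_mul]
  refine Finset.sum_le_sum fun i _ => ?_
  rw [norm_smul]
  calc ‖w i‖ * ‖Torus.partialDeriv i (force S c) x‖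
      ≤ ‖w‖ * ∑ k : ↥S, 2 * Real.pi * |(((k : Fin 3 → ℤ) i : ℤ) : ℝ)| * ‖c k‖ :=
        mul_le_mul (PiLp.norm_apply_le w i) (norm_partialDeriv_force_le S c i x) (norm_nonneg _) (norm_nonneg _)
    _ = (∑ k : ↥S, 2 * Real.pi * |(((k : Fin 3 → ℤ) i : ℤ) : ℝ)| * ‖c k‖) * ‖w‖ := mul_comm _ _

/-- SELF-PAIRING ON A WINDOW: `∫‖f_c‖² ≤ Λ(c)·E` for every `c` in a window. -/
theorem forceEnergy_le_of_window {U : Set (↥S → (EuclideanSpace ℂ (Fin 3)))} (hU : IsWindow S E ε U) {c : ↥S → (EuclideanSpace ℂ (Fin 3))} (hc : c ∈ U) :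
    ∫ x, ‖force S c x‖ ^ 2 ≤ gradBound S c * E := by
  have h := abs_pairing_le_of_window hU hc (isSmooth_force S c) (isDivFree_force S c) (norm_fderiv_force_le S c)
  have heq : ∫ x, ⟪force S c x, force S c x⟫_ℝ = ∫ x, ‖force S c x‖ ^ 2 :=
    integral_congr_ae (ae_of_all _ fun x => real_inner_self_eq_norm_sq _)
  rw [heq] at h
  exact (le_abs_self _).trans h

/-- HEADLINE: on every window `ε² ≤ Λ(c)·E²` — the dissipation floor is at most the energy budget times the
square root of the force-gradient bound, at EVERY point of the window. -/
theorem sq_le_gradBound_mul_sq_of_window (hε : 0 < ε) {U : Set (↥S → (EuclideanSpace ℂ (Fin 3)))} (hU : IsWindow S E ε U)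
    {c : ↥S → (EuclideanSpace ℂ (Fin 3))} (hc : c ∈ U) : ε ^ 2 ≤ gradBound S c * E ^ 2 := by
  have hE := (energy_pos_of_window hε hU).le
  -- power budget on the closure of `LOUD_0`, via continuity of `c ↦ ∫‖f_c‖²`
  have hclosed : IsClosed {c : ↥S → (EuclideanSpace ℂ (Fin 3)) | ε ^ 2 ≤ (∫ x, ‖force S c x‖ ^ 2) * E} :=
    isClosed_le continuous_const ((continuous_forceEnergy S).mul continuous_const)
  have h1 : ε ^ 2 ≤ (∫ x, ‖force S c x‖ ^ 2) * E :=
    closure_minimal (fun c hc => sq_le_integral_force_mul_of_mem_loudSet hε.le hc) hclosed (hU.2.2 0 hc)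
  calc ε ^ 2 ≤ (∫ x, ‖force S c x‖ ^ 2) * E := h1
    _ ≤ gradBound S c * E * E := mul_le_mul_of_nonneg_right (forceEnergy_le_of_window hU hc) hE
    _ = gradBound S c * E ^ 2 := by ring

/-- EXPLICIT HEADLINE: `ε² ≤ Λ₁(S) ‖c‖ E²` on every window, `Λ₁(S) = 2π ∑ᵢ ∑_{k∈S} |kᵢ|`. -/
theorem sq_le_explicit_of_window (hε : 0 < ε) {U : Set (↥S → (EuclideanSpace ℂ (Fin 3)))} (hU : IsWindow S E ε U)
    {c : ↥S → (EuclideanSpace ℂ (Fin 3))} (hc : c ∈ U) :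
    ε ^ 2 ≤ (∑ i : Fin 3, ∑ k : ↥S, 2 * Real.pi * |(((k : Fin 3 → ℤ) i : ℤ) : ℝ)|) * ‖c‖ * E ^ 2 :=
  (sq_le_gradBound_mul_sq_of_window hε hU hc).trans
    (mul_le_mul_of_nonneg_right (gradBound_le S c) (sq_nonneg _))

end Consequences

end Summit.AnomalousDissipation.AnomalousDissipation.Theorems.DenseLoudDesignerForces.Negative

end
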